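import Summits.QuantumFields.YangMills.Theorems.AtomicSynthesisTensorisation
import HarnessLib

/-!
# `stub_tensorisation` of LINE «SlotwiseSynthesis» (crux AtomicSynthesis ⟨stmt-QuantumFields-28126⟩) BY NAME AND SIGNATURE

The registered stub text (skeleton ym-idea-11 g13 `slotwise-synthesis.lean`, sha 78fb3dad):
`theorem stub_tensorisation : ∀ (b : SchwartzMap E4 ℝ) (C₁ : ℝ) (N₁ : ℕ), 0 ≤ C₁ → SlotSynth b C₁ N₁ → SynthFor b`,
with `SynthFor` copied VERBATIM (a registered-stub copy, not a citable fact; `SlotSynth` is the tree's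
`RPOnsetFloorPosTimeSynthCollar.SlotSynth`, `E4` the tree's `SingleSlotPlan.E4`).  The proof is the landed tensorisation
`AtomicSynthesisTensor.synthFor_of_slotSynth` (`AtomicSynthesisTensorisation`), whose conclusion is `SynthFor b` unfolded.

HONEST LABEL: registry bookkeeping for a pure-analysis stub; the crux itself is closed by
`AtomicSynthesisTensor.atomicSynthesis_proof`; no rung / leaf / summit statement; YM mass gap NOT proved.
Cell `ym-idea-1`, width seat `ym-line-sfw-p2-w3` g37 (free hands).
-/

noncomputable section

open Summit.QuantumFields.YangMills.Theorems.RPOnsetFloorPosTimeSynthCollar (SlotSynth)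
open Summit.QuantumFields.YangMills.Cruxes.AtomicSynthesis.SingleSlotPlan (E4)

namespace Summit.QuantumFields.YangMills.Theorems.AtomicSynthesisTensor

/-- THE CRUX'S CONCLUSION FOR ONE BUMP `b` (the body of `AtomicSynthesis` after the `b`-binders; verbatim the
skeleton's `SynthFor` — a registered-stub copy, not a citable fact). -/
abbrev SynthFor (b : SchwartzMap E4 ℝ) : Prop :=
  ∃ (C : ℝ) (N : ℕ), 0 ≤ C ∧ ∀ (n : ℕ), 1 ≤ n →
    ∀ (F : SchwartzMap (Fin n → EuclideanSpace ℝ (Fin 4)) ℝ) (c : Fin n → EuclideanSpace ℝ (Fin 4))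
      (ρ M : ℝ), 0 < ρ → tsupport F ⊆ {z | ∀ l, ‖z l - c l‖ ≤ ρ} →
      (∀ m : ℕ, m ≤ N * n → ∀ z, ‖iteratedFDeriv ℝ m F z‖ ≤ M / ρ ^ m) →
      ∃ (coef : ℕ → ℝ) (σ : ℕ → Fin n → ℝ) (η : ℕ → Fin n → EuclideanSpace ℝ (Fin 4)),
        Summable (fun i => |coef i|) ∧ ∑' i, |coef i| ≤ C ^ n * M ∧
        (∀ i l, 0 < σ i l ∧ σ i l ≤ ρ ∧ ‖η i l - c l‖ ≤ 2 * ρ) ∧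
        ∀ z, F z = ∑' i, coef i * ∏ l, b ((σ i l)⁻¹ • (z l - η i l))

/-- **`stub_tensorisation`** — the registered stub of crux AtomicSynthesis ⟨stmt-QuantumFields-28126⟩ (LINE
«SlotwiseSynthesis») BY NAME AND SIGNATURE: single-slot synthesis with constants `C₁, N₁` gives the crux's conclusion
for `b`. [folklore] -/
theorem stub_tensorisation :
    ∀ (b : SchwartzMap E4 ℝ) (C₁ : ℝ) (N₁ : ℕ), 0 ≤ C₁ → SlotSynth b C₁ N₁ → SynthFor b :=
  fun b C₁ N₁ hC₁ hS => synthFor_of_slotSynth b C₁ N₁ hC₁ hS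

end Summit.QuantumFields.YangMills.Theorems.AtomicSynthesisTensor

end
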